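import Literature.AlgebraicGeometry.HilbertScheme.TransferOperatorSuperCommutators
import HarnessLib

/-!
# The Poincaré pairing of a smooth projective variety has an (even) Casimir element (proved)

Layer `Literature/AlgebraicGeometry/HilbertScheme`; theorems only, no definition, no named fact.  The transfer
operators `T(φ) = −Σₙ n^{t−1} Σᵢ 𝔮ₙ(φ εᵢ) 𝔮₋ₙ(eᵢ)` of `HeisenbergFockSpace` / `TransferOperatorCommutators` /
`TransferOperatorSuperCommutators` / `LefschetzDualHilbertScheme` are written with a CASIMIR ELEMENT
`C = Σᵢ eᵢ ⊗ εᵢ ∈ H*(S) ⊗ H*(S)` of the Poincaré pairing `⟨a, b⟩ = ∫_S a ∪ b` (`IsCasimir`: `Σᵢ ⟨eᵢ, v⟩ εᵢ = v` for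
every `v`; Lehn, Invent. Math. 136 (1999) §3.1: "the linear map adjoint to the cup-product map"; Li–Qin–Wang,
Math. Ann. 324 (2002) Def. 2.9 (iii): the Künneth decomposition of a class of `S × S`), and every consumer so far
carries the hypotheses `(hC : IsCasimir ℂ (poincarePairing hS) C)` and `(hCg : C ∈ evenTensorSpan ℂ (coeffFamily S))`.
This file PROVES that such an element exists, for every smooth projective complex variety `X` of any dimension
`n`:

* `exists_isCasimir_mem_evenTensorSpan` — **there is `C ∈ evenTensorSpan` with `IsCasimir ℂ (poincarePairing hX) C`**;
* `exists_isCasimir` — the plain existence corollary.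

The proof is the textbook one.  `Hᵏ(X(ℂ); ℂ)` is finite-dimensional (`X(ℂ)` is a compact `2n`-manifold) and
vanishes for `k > 2n`; for `i + k = 2n` the cup-product pairing `Hⁱ × Hᵏ → ℂ`, `(u, w) ↦ ⟨u ∪ w, [X(ℂ)]⟩`, is
PERFECT (Poincaré duality over a field, Hatcher Prop. 3.38 — the tree's `isPerfPair_cupPairing_complexPoints`), so
a basis `(x^{i}_a)_a` of `Hⁱ` has a dual family `(y^{i}_a)_a` in `Hᵏ` (`⟨x_a ∪ y_b, [X(ℂ)]⟩ = δ_{ab}`, the tree's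
`PerfPairDuality.exists_dual`, `eq_sum_smul_dual`).  Since the tree's trace is `∫_X = ε₀⁻¹ ⟨·, [X(ℂ)]⟩`
(`traceC_apply`, `ε₀ = pointSign ≠ 0`), the element
`C = Σ_{i+k=2n} Σ_a x^{i}_a ⊗ ε₀ y^{i}_a`
satisfies `Σ ⟨x_a, v⟩ ε₀ y_a = v` on every homogeneous `v ∈ Hᵏ(X(ℂ))`, `k ≤ 2n` (only the block `i = 2n − k`
pairs non-trivially with `Hᵏ`, `totalTraceC_ofDegree_of_ne`), and trivially on `Hᵏ = 0`, `k > 2n`; every term has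
total degree `i + k = 2n`, even.

## Sources

* M. Lehn, Invent. Math. 136 (1999), §3.1 p. 8 (the adjoint of the cup product / Künneth components of the
  diagonal). [Lehn1999]
* W.-P. Li, Z. Qin, W. Wang, Math. Ann. 324 (2002), Def. 2.9 (iii) p. 5. [LiQinWang2002]
* A. Hatcher, Algebraic Topology (2002), §3.3 Prop. 3.38 (the cup product pairing is non-singular over a field).
  [HatcherAT2002]

## Not here

Uniqueness of the Casimir element (true: the pairing is perfect on the finite-dimensional `H*(X(ℂ); ℂ)`), and
hence "every Casimir element is even"; consumers that need evenness take the element provided here.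
-/

noncomputable section

open DirectSum TensorProduct
open Literature.AlgebraicTopology.SingularHomology
open Literature.AlgebraicGeometry.Motives (SchemeOver ComplexPoints IsSmoothProjective)
open Literature.AlgebraicGeometry.Hyperkaehler (totalCohomology ofDegree totalCup)
open Literature.AlgebraicGeometry.HodgeTheory (complexBetti traceC traceC_apply pointSign pointSign_ne_zero
  complexOrientationFamily isPerfPair_cupPairing_complexPoints)

namespace Literature.AlgebraicGeometry.HilbertScheme

variable {n : ℕ} {X : SchemeOver ℂ}

/-! ### The Poincaré pairing on homogeneous classes -/

/-- Re-indexing a homogeneous cup product along an equality of degrees (plumbing). [folklore] -/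
private theorem ofDegree_cupProduct_congr {i k m : ℕ} (h : i + k = m) (u : complexBetti X i)
    (w : complexBetti X k) :
    ofDegree ℂ (ComplexPoints X) (i + k) (cupProduct rfl u w) = ofDegree ℂ (ComplexPoints X) m (cupProduct h u w) := by
  subst h
  rfl

/-- **Homogeneous classes of non-complementary degrees are orthogonal**: `∫_X u ∪ w = 0` for `u ∈ Hⁱ`, `w ∈ Hᵏ`,
`i + k ≠ 2 dim X`. [cite: Lehn1999, Def. 2.3 p. 7] -/
theorem poincarePairing_ofDegree_of_ne (hX : IsSmoothProjective n X) {i k : ℕ} (h : i + k ≠ 2 * n)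
    (u : complexBetti X i) (w : complexBetti X k) :
    poincarePairing hX (ofDegree ℂ (ComplexPoints X) i u) (ofDegree ℂ (ComplexPoints X) k w) = 0 := by
  rw [poincarePairing_apply, Hyperkaehler.totalCup_lof, totalTraceC_ofDegree_of_ne hX h]

/-- **In complementary degrees the Poincaré pairing is the cup-product pairing of the complex orientation, up
to the point sign**: `∫_X u ∪ w = ε₀⁻¹ · ⟨u ∪ w, [X(ℂ)]⟩` for `u ∈ Hⁱ`, `w ∈ Hᵏ`, `i + k = 2 dim X`.
[cite: HatcherAT2002, §3.3 p. 249 (the pairing of Prop. 3.38)] -/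
theorem poincarePairing_ofDegree_eq_cupPairing (hX : IsSmoothProjective n X) {i k : ℕ} (h : i + k = 2 * n)
    (u : complexBetti X i) (w : complexBetti X k) :
    poincarePairing hX (ofDegree ℂ (ComplexPoints X) i u) (ofDegree ℂ (ComplexPoints X) k w) =
      ((pointSign : ℂ))⁻¹ * cupPairing (complexOrientationFamily hX) h u w := by
  rw [poincarePairing_apply, Hyperkaehler.totalCup_lof, ofDegree_cupProduct_congr h, totalTraceC_ofDegree_top,
    traceC_apply, cupPairing_apply]

/-! ### Existence of an even Casimir element -/

/-- **The Poincaré pairing `⟨a, b⟩ = ∫_X a ∪ b` of a smooth projective complex variety has an EVEN Casimir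
element**: there is `C = Σᵢ eᵢ ⊗ εᵢ ∈ H*(X(ℂ); ℂ) ⊗ H*(X(ℂ); ℂ)`, a sum of pure tensors of homogeneous classes of even
total degree (`evenTensorSpan`; here `|eᵢ| + |εᵢ| = 2 dim X`), with `Σᵢ ⟨eᵢ, v⟩ εᵢ = v` for every `v` (`IsCasimir`).
Construction: dual bases of `Hⁱ` and `H^{2n−i}` for the perfect cup-product pairing (Poincaré duality over `ℂ`),
rescaled by the point sign of the tree's trace. [cite: Lehn1999, §3.1 p. 8] [cite: HatcherAT2002, §3.3 Prop. 3.38] -/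
theorem exists_isCasimir_mem_evenTensorSpan (hX : IsSmoothProjective n X) :
    ∃ C ∈ evenTensorSpan ℂ (coeffFamily X), IsCasimir ℂ (poincarePairing hX) C := by
  classical
  letI := hX.chartedSpace
  haveI := Motives.ComplexPoints.compactSpace_of_isSmoothProjective hX
  haveI := Motives.ComplexPoints.t2Space_of_isSmoothProjective hX
  haveI hfin : ∀ k, Module.Finite ℂ (complexBetti X k) := fun k ↦
    finite_singularCohomology_of_compact_chartedSpace ℂ ℂ (d := 2 * n) k
  -- a basis of every `Hⁱ`, and for `i + k = 2n` its dual family in `Hᵏ` for the cup-product pairing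
  let x : (p : ℕ × ℕ) → Module.Basis (Fin (Module.finrank ℂ (complexBetti X p.1))) ℂ (complexBetti X p.1) :=
    fun p ↦ Module.finBasis ℂ (complexBetti X p.1)
  have hdual : ∀ p : ℕ × ℕ, ∀ h : p.1 + p.2 = 2 * n,
      ∃ y : Fin (Module.finrank ℂ (complexBetti X p.1)) → complexBetti X p.2,
        ∀ a b, cupPairing (complexOrientationFamily hX) h (x p a) (y b) = if a = b then 1 else 0 :=
    fun p h ↦ HodgeTheory.PerfPairDuality.exists_dual
      (isPerfPair_cupPairing_complexPoints complexOrientationFamily hX h) (x p)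
  choose y hy using hdual
  let y' : (p : ℕ × ℕ) → Fin (Module.finrank ℂ (complexBetti X p.1)) → complexBetti X p.2 :=
    fun p ↦ if h : p.1 + p.2 = 2 * n then y p h else 0
  set c : ℂ := (pointSign : ℂ) with hc
  have hc0 : c ≠ 0 := by rw [hc]; exact_mod_cast pointSign_ne_zero
  -- the element
  refine ⟨∑ p ∈ Finset.HasAntidiagonal.antidiagonal (2 * n), ∑ a, ofDegree ℂ (ComplexPoints X) p.1 (x p a) ⊗ₜ[ℂ]
      ofDegree ℂ (ComplexPoints X) p.2 (c • y' p a), ?_, ?_⟩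
  · -- evenness: every term has total degree `2n`
    refine Submodule.sum_mem _ fun p hp ↦ Submodule.sum_mem _ fun a _ ↦ ?_
    exact tmul_mem_evenTensorSpan (A := coeffFamily X) ⟨n, by rw [Finset.HasAntidiagonal.mem_antidiagonal.mp hp]; ring⟩ _ _
  · -- the Casimir property, first on homogeneous classes
    have key : ∀ (j : ℕ) (b : complexBetti X j),
        (∑ p ∈ Finset.HasAntidiagonal.antidiagonal (2 * n), ∑ a,
          poincarePairing hX (ofDegree ℂ (ComplexPoints X) p.1 (x p a)) (ofDegree ℂ (ComplexPoints X) j b) •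
            ofDegree ℂ (ComplexPoints X) p.2 (c • y' p a)) = ofDegree ℂ (ComplexPoints X) j b := by
      intro j b
      by_cases hj : j ≤ 2 * n
      · have h₀ : (2 * n - j) + j = 2 * n := Nat.sub_add_cancel hj
        have hp₀ : (2 * n - j, j) ∈ Finset.HasAntidiagonal.antidiagonal (2 * n) := Finset.HasAntidiagonal.mem_antidiagonal.mpr h₀
        rw [Finset.sum_eq_single_of_mem (2 * n - j, j) hp₀]
        · -- the block `i = 2n - j`: dual bases
          have hy₀ : ∀ a b, cupPairing (complexOrientationFamily hX) h₀ (x (2 * n - j, j) a) (y' (2 * n - j, j) b) =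
              if a = b then 1 else 0 := by
            intro a b
            simp only [y', dif_pos h₀]
            exact hy (2 * n - j, j) h₀ a b
          simp only [poincarePairing_ofDegree_eq_cupPairing hX h₀, map_smul, smul_smul]
          calc ∑ a, (c⁻¹ * cupPairing (complexOrientationFamily hX) h₀ (x (2 * n - j, j) a) b * c) •
                  ofDegree ℂ (ComplexPoints X) j (y' (2 * n - j, j) a)
              = ∑ a, cupPairing (complexOrientationFamily hX) h₀ (x (2 * n - j, j) a) b •
                  ofDegree ℂ (ComplexPoints X) j (y' (2 * n - j, j) a) :=
                Finset.sum_congr rfl fun a _ ↦ by rw [mul_comm, ← mul_assoc, mul_inv_cancel₀ hc0, one_mul]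
            _ = ofDegree ℂ (ComplexPoints X) j
                  (∑ a, cupPairing (complexOrientationFamily hX) h₀ (x (2 * n - j, j) a) b • y' (2 * n - j, j) a) := by
                rw [map_sum]
                simp only [map_smul]
            _ = ofDegree ℂ (ComplexPoints X) j b := by
                rw [← HodgeTheory.PerfPairDuality.eq_sum_smul_dual
                  (isPerfPair_cupPairing_complexPoints complexOrientationFamily hX h₀) (x (2 * n - j, j)) hy₀ b]
        · -- the other blocks pair trivially with `Hʲ`
          intro p hp hne
          have hpj : p.1 + j ≠ 2 * n := by
            intro hpj
            apply hne
            have hp' := Finset.HasAntidiagonal.mem_antidiagonal.mp hp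
            ext <;> simp only <;> omega
          simp only [poincarePairing_ofDegree_of_ne hX hpj, zero_smul, Finset.sum_const_zero]
      · -- `Hʲ = 0` above the top degree
        haveI := Motives.ComplexPoints.subsingleton_singularCohomology_of_lt hX ℂ (k := j) (by omega)
        rw [Subsingleton.elim b 0]
        simp only [map_zero, zero_smul, Finset.sum_const_zero]
    -- then on all of `H*` by linearity
    intro v
    simp only [map_sum, TensorProduct.lift.tmul, LinearMap.coe_comp, Function.comp_apply, LinearMap.flip_apply,
      LinearMap.lsmul_apply]
    induction v using DirectSum.induction_on with
    | zero => simp only [map_zero, zero_smul, Finset.sum_const_zero]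
    | of j b => exact key j b
    | add u w hu hw =>
      simp only [map_add, add_smul, Finset.sum_add_distrib]
      rw [hu, hw]

/-- **The Poincaré pairing of a smooth projective complex variety has a Casimir element** (plain existence; the
shape of the lane-(V) seam "`PoincareCasimirExists`"). [cite: Lehn1999, §3.1 p. 8] [cite: HatcherAT2002, §3.3 Prop. 3.38] -/
theorem exists_isCasimir (hX : IsSmoothProjective n X) :
    ∃ C : totalCohomology ℂ (ComplexPoints X) ⊗[ℂ] totalCohomology ℂ (ComplexPoints X),
      IsCasimir ℂ (poincarePairing hX) C := by
  obtain ⟨C, -, hC⟩ := exists_isCasimir_mem_evenTensorSpan hX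
  exact ⟨C, hC⟩

end Literature.AlgebraicGeometry.HilbertScheme

end
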